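import Summits.BirchSwinnertonDyer.Rank1Residual.AdditivePotMult.QuadraticBaseChangeOddTamagawaAdditiveAll
import Summits.BirchSwinnertonDyer.Rank1Residual.AdditivePotMult.QuadraticBaseChangeTamagawaTypeIVInert
import Literature.NumberTheory.EllipticCurves.NeronComponentDataProofs
import Literature.NumberTheory.EllipticCurves.NeronTamagawa
import HarnessLib

/-!
# The odd Tamagawa identity at EVERY odd `p` (`p = 3` included) with additive places prime to
# `d_K` allowed, CONDITIONAL on the unramified-base-change fact A233
# (row T-MIL-3, FILE H-1 — the `p = 3` twin of FILE C-3h; seat n1011-p01 GEN 8)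

HONEST FRAMING (cell `b2b-bsdres`, run/shared/lean/b2b/bsd-rank1-residual/, verbatim in every
file): the goal of the cell is to DELETE the COMBINATION-SHAPED residual classes of the
Birch–Swinnerton-Dyer formula for ALL analytic-rank `≤ 1` elliptic curves over `ℚ` — "full BSD
formula for every rank `≤ 1` curve in class `C`" assembled STRICTLY from published theorems — so
that the rank-`≤ 1` remainder becomes exactly the CONSTRUCTION-SHAPED classes, which are TYPED
(missing-input `Prop`s), NOT attempted. This is not "finishing BSD". Sub-classes X3♯(M) / X4(M)
(additive, potentially multiplicative prime; base-change-and-descend): a RESEARCH ROUTE; they stay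
CONSTRUCTION-SHAPED; nothing is booked by this file; no mark / label moved. THEOREMS ONLY: no
definition, no named fact, no `sorry`.

## What

FILE C-3h (`QuadraticBaseChangeOddTamagawaAdditiveAll`) proves the odd Tamagawa identity of Milne's
quadratic BSD quotient (the body of the `hodd` binder) with ALL additive places prime to `d_K`
allowed, for `p ≥ 5`, CONDITIONAL on A233 (`hA`): every additive Tamagawa number is `≤ 4 < p`. At
`p = 3` — THE prime of the additive block N10/N11 — the types `IV` / `IV*` have `c ∈ {1, 3}` and the
per-place identity (T) `Σ_{w ∣ v} v₃(c_w(W_K)) = v₃(c_v(W)) + v₃(c_v(W_d))` is a genuine FLIP at an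
inert place, proved FACT-FREE by row T-MIL-B (n1011-p08, B-2e / B-3, `ℓ ≠ 2, 3`). This file does the
rest: §1 over ANY number field, `c_w ∣ #Φ_w(k̄)` (tree `localTamagawaNumber_dvd_componentGroupOrder`
with the discharged `nonempty_neronComponentData_holds`) and the additive types have
`#Φ ∈ {1, 2, 3, 4}`, `= 3` exactly for `IV` / `IV*` (*ATAEC* Table 4.1), so `v_p(c_w) = 0` for odd
`p` off (`p = 3` ∧ type `IV`/`IV*`); §2 the Kodaira symbol upstairs equals the one downstairs above
an unramified place (A233's first conjunct, `hA`, in C-3h's `(hw, he)` currency); §3 (T) at `p = 3`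
at an INERT additive place of type `∉ {IV, IV*}`, ANY `ℓ ≠ 3`, GIVEN `hA`: `0 = 0 + 0`, the twist
term WITHOUT Kodaira transport for twists (if `3 ∣ c_v(W_d)` then `W_d` is of type `IV`/`IV*`, p08's
FACT-FREE `K`-side gives `c_w(W_{d,K}) = 3 = c_w(W_K)` by the A-4K transfer — against the `K`-side
zero); §4 the per-place (T) and **THE END `padicValRat_norm_mul_tamagawaProduct_eq_of_unramifiedFact_odd`
at every odd `p`**, C-3h's S₃ hypothesis carrying ONE proviso in its additive disjunct,
`p = 3 → ℓ_v ≠ 3 ∧ (ℓ_v = 2 → d_K ≡ 1 (mod 8) ∨ W.kodairaSymbolAt v ≠ IV, IV*)` (census-decidable;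
vacuous for `p ≥ 5`, so the END SUBSUMES C-3h's).

HONEST LIMITS (said loudly): CONDITIONAL on A233 (`hA`, a named fact, not discharged here — row
T-A233 of n1011-p16); NOT covered at `p = 3`: additive places over `2` of type `IV`/`IV*` with `2`
inert in `K` (the `ℓ = 2` unit-twist FLIP, row T-MIL-B's 'OUT', now row T-MIL-B2 of n1011-p16), and
additive `W` at an UNRAMIFIED `3` (never in-class: the descent at `p` uses `K` ramified at `p`);
`d_K` odd squarefree; closes no class; moves no mark; C-3h stays as the dominated `p ≥ 5` twin.

References: Silverman *ATAEC* Cor. IV.9.2, Thm. IV.9.4, Table 4.1 [SilvermanATAEC1994]; *AEC*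
Prop. VII.5.4 (a), VII.6.1 [SilvermanAEC2009]; Milne 1972 §1 [Milne1972ArithmeticAV]; [DokchitserDokchitserAnnals2010] §2.1.
-/

noncomputable section

open scoped Classical NumberField

open WeierstrassCurve NumberField IsDedekindDomain Rat.HeightOneSpectrum
  Literature.NumberTheory.EllipticCurves Literature.NumberTheory.DiophantineGeometry IsLocalRing
  Summit.BirchSwinnertonDyer.Rank1Residual.Additive

namespace Summit.BirchSwinnertonDyer.Rank1Residual.AdditivePotMult

/-! ## §1 `v_p(c_w) = 0` at an additive place for odd `p`, off the types `IV` / `IV*` at `p = 3` -/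

section ComponentGroup

/-- **`3 ∣ #Φ(k̄)` for an ADDITIVE Kodaira type iff the type is `IV` or `IV*`** (Silverman
*ATAEC* Table 4.1: the additive types `II, III, IV, I₀*, Iₙ*, IV*, III*, II*` have component groups
of order `1, 2, 3, 4, 4, 3, 2, 1`; tree `KodairaSymbol.componentGroupOrder`).
[cite: SilvermanATAEC1994, Table 4.1 (PDF p. 365)] -/
theorem KodairaSymbol.three_dvd_componentGroupOrder_iff_of_isAdditive {k : KodairaSymbol}
    (hk : k.IsAdditive) : 3 ∣ k.componentGroupOrder ↔ k = .IV ∨ k = .IVstar := by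
  rw [← KodairaSymbol.tameConductorExponent_eq_two_iff] at hk
  rcases k with (_ | n) | _ | _ | _ | n | _ | _ | _ <;>
    simp_all [KodairaSymbol.componentGroupOrder, KodairaSymbol.tameConductorExponent]

/-- **An odd prime divides `#Φ(k̄)` of an ADDITIVE Kodaira type only if it is `3` and the type is
`IV` or `IV*`** (the orders are `1, 2, 3, 4, 4, 3, 2, 1`, *ATAEC* Table 4.1).
[cite: SilvermanATAEC1994, Table 4.1 (PDF p. 365)] -/
theorem KodairaSymbol.eq_IV_or_IVstar_of_prime_dvd_componentGroupOrder_of_isAdditive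
    {k : KodairaSymbol} (hk : k.IsAdditive) {p : ℕ} (hp : p.Prime) (hp2 : p ≠ 2)
    (hdvd : p ∣ k.componentGroupOrder) : p = 3 ∧ (k = .IV ∨ k = .IVstar) := by
  rw [← KodairaSymbol.tameConductorExponent_eq_two_iff] at hk
  have hp1 : p ≠ 1 := hp.one_lt.ne'
  have hp2' : ¬ p ∣ 2 := fun h2 => hp2 ((Nat.prime_dvd_prime_iff_eq hp Nat.prime_two).mp h2)
  have hp4 : ¬ p ∣ 4 := fun h => by
    rcases (Nat.Prime.dvd_mul hp).mp (show p ∣ 2 * 2 by simpa using h) with h2 | h2 <;> exact hp2' h2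
  have hp3 : p ∣ 3 → p = 3 := fun h3 => (Nat.prime_dvd_prime_iff_eq hp Nat.prime_three).mp h3
  rcases k with (_ | n) | _ | _ | _ | n | _ | _ | _ <;>
    simp_all [KodairaSymbol.componentGroupOrder, KodairaSymbol.tameConductorExponent]

variable {F : Type*} [Field F] [NumberField F] (w : HeightOneSpectrum (𝓞 F)) (X : WeierstrassCurve F)
  [X.IsElliptic]

/-- **`v_p(c_w) = 0` at an ADDITIVE place for odd `p`, unless `p = 3` and the type is `IV`/`IV*`**
(`X` elliptic over a number field `F`, `w` a finite place): `c_w = [X(F_w) : X₀(F_w)]` divides the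
order of the geometric component group `#Φ_w(k̄)` (Silverman *ATAEC* Cor. IV.9.2 (c),(d); tree
`localTamagawaNumber_dvd_componentGroupOrder` with the discharged `nonempty_neronComponentData_holds`),
which for the additive types is `1, 2, 3, 4, 4, 3, 2, 1` (Table 4.1), divisible by an odd prime only
at `3 ∣ #Φ(IV) = #Φ(IV*) = 3`; additivity of the symbol by the discharged
`isAdditive_kodairaSymbolAt_iff_holds`. At `p ≥ 5` this is FILE C-3h's `c ≤ 4 < p`.
[cite: SilvermanATAEC1994, Cor. IV.9.2 (c),(d), IV.9.4 and Table 4.1] -/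
theorem padicValNat_localTamagawaNumber_eq_zero_of_hasAdditiveReductionAt_of_odd
    (hadd : X.HasAdditiveReductionAt w) (p : ℕ) [hp : Fact p.Prime] (hp2 : p ≠ 2)
    (h3 : p = 3 → X.kodairaSymbolAt w ≠ .IV ∧ X.kodairaSymbolAt w ≠ .IVstar) :
    padicValNat p ((X.baseChange (w.adicCompletion F)).localTamagawaNumber
        (w.adicCompletionIntegers F)) = 0 := by
  haveI : Finite (ResidueField (w.adicCompletionIntegers F)) :=
    HeightOneSpectrum.finite_residueField_adicCompletionIntegers F w
  haveI : PerfectField (ResidueField (w.adicCompletionIntegers F)) := PerfectField.ofFinite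
  have hkadd : (X.kodairaSymbolAt w).IsAdditive := (isAdditive_kodairaSymbolAt_iff_holds w X).mpr hadd
  have hcgo := localTamagawaNumber_dvd_componentGroupOrder w X (nonempty_neronComponentData_holds X w)
  refine padicValNat.eq_zero_of_not_dvd fun hdvd => ?_
  obtain ⟨hp3, hIV⟩ := KodairaSymbol.eq_IV_or_IVstar_of_prime_dvd_componentGroupOrder_of_isAdditive
    hkadd hp.out hp2 (hdvd.trans hcgo)
  exact hIV.elim (h3 hp3).1 (h3 hp3).2

/-- **`3 ∣ c_w` at an ADDITIVE place forces type `IV` or `IV*`** (same table: `c_w ∣ #Φ_w(k̄)` and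
`3 ∣ #Φ` only for `IV`, `IV*` among the additive types).
[cite: SilvermanATAEC1994, Cor. IV.9.2 (c),(d), IV.9.4 and Table 4.1] -/
theorem kodairaSymbolAt_eq_IV_or_IVstar_of_three_dvd_localTamagawaNumber
    (hadd : X.HasAdditiveReductionAt w)
    (hdvd : 3 ∣ (X.baseChange (w.adicCompletion F)).localTamagawaNumber (w.adicCompletionIntegers F)) :
    X.kodairaSymbolAt w = .IV ∨ X.kodairaSymbolAt w = .IVstar := by
  haveI : Finite (ResidueField (w.adicCompletionIntegers F)) :=
    HeightOneSpectrum.finite_residueField_adicCompletionIntegers F w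
  haveI : PerfectField (ResidueField (w.adicCompletionIntegers F)) := PerfectField.ofFinite
  have hkadd : (X.kodairaSymbolAt w).IsAdditive := (isAdditive_kodairaSymbolAt_iff_holds w X).mpr hadd
  have hcgo := localTamagawaNumber_dvd_componentGroupOrder w X (nonempty_neronComponentData_holds X w)
  exact (KodairaSymbol.three_dvd_componentGroupOrder_iff_of_isAdditive hkadd).mp (hdvd.trans hcgo)

end ComponentGroup

/-! ## §2 The Kodaira symbol above an unramified place, GIVEN A233 -/

section Bridge

variable {K : Type} [Field K] [NumberField K] {v : HeightOneSpectrum (𝓞 ℚ)}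
  {w : HeightOneSpectrum (𝓞 K)} (W : WeierstrassCurve ℚ) [W.IsElliptic]

/-- **The Kodaira symbol upstairs equals the one downstairs above an unramified place, GIVEN A233**
(`W/ℚ` elliptic, `w | v` with `e(w | v) = 1`): `(W_K).kodairaSymbolAt w = W.kodairaSymbolAt v` —
the first conjunct of the named fact (tree `kodairaSymbolAt_baseChange_eq`), fed exactly as C-3h's
bridge `hasAdditiveReductionAt_baseChange_of_unramifiedFact` (square `𝓞 ℚ → ℚ → K = 𝓞 ℚ → 𝓞 K → K`,
perfect finite residue fields, `not_map_le_sq_of_ramificationIdx_eq_one`). CONDITIONAL on `hA`. [cite: SilvermanAEC2009, Prop. VII.5.4 (a) with proof] -/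
theorem kodairaSymbolAt_baseChange_eq_of_unramifiedFact
    (hA : kodairaSymbolAt_baseChange_of_ramificationIdx_eq_one K v w W)
    (hw : w.under (𝓞 ℚ) = v) (he : w.asIdeal.ramificationIdx (𝓞 ℚ) = 1) :
    (W.baseChange K).kodairaSymbolAt w = W.kodairaSymbolAt v := by
  haveI : Finite (ResidueField (v.adicCompletionIntegers ℚ)) :=
    finite_residueField_adicCompletionIntegers_rat v
  haveI : PerfectField (ResidueField (v.adicCompletionIntegers ℚ)) := PerfectField.ofFinite
  haveI : Finite (ResidueField (w.adicCompletionIntegers K)) :=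
    HeightOneSpectrum.finite_residueField_adicCompletionIntegers K w
  haveI : PerfectField (ResidueField (w.adicCompletionIntegers K)) := PerfectField.ofFinite
  have hc : (algebraMap ℚ K).comp (algebraMap (𝓞 ℚ) ℚ) =
      (algebraMap (𝓞 K) K).comp (algebraMap (𝓞 ℚ) (𝓞 K)) := by
    rw [← IsScalarTower.algebraMap_eq, ← IsScalarTower.algebraMap_eq]
  have hwv : w.asIdeal.under (𝓞 ℚ) = v.asIdeal := by rw [← hw]; rfl
  exact kodairaSymbolAt_baseChange_eq hA hc hwv (not_map_le_sq_of_ramificationIdx_eq_one hw he)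

end Bridge

/-! ## §3 (T) at `p = 3` at an INERT additive place of type `∉ {IV, IV*}`, GIVEN A233 -/

section InertNeIV

variable (W : WeierstrassCurve ℚ) [W.IsElliptic] [W.IsGloballyMinimal] {K : Type} [Field K]
  [NumberField K] (Wd : WeierstrassCurve ℚ) [Wd.IsElliptic] (v : HeightOneSpectrum (𝓞 ℚ))

/-- **(T) at `p = 3` at an INERT ADDITIVE place of Kodaira type `∉ {IV, IV*}`, ANY residue
characteristic `ℓ ≠ 3` (`ℓ = 2` included), GIVEN A233 above `v`** (`W/ℚ` globally minimal,
`[K:ℚ] = 2` with `d_K` odd, one place `w` above `v` with `e = 1`, `f = 2`, `ℓ ∤ d_K`,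
`W_d = C_d • W^{(d_K)}`): `v₃(c_w(W_K)) = 0 = v₃(c_v(W)) + v₃(c_v(W_d))`. `K`-side: `W_K` is
additive at `w` (C-3h bridge) of the SAME type (§2), so §1 applies over `K`. `ℚ`-side: §1 for `W`;
`W_d` is additive at `v` (A-5a `hasAdditiveReductionAt_quadraticTwist_of_not_dvd` at odd `ℓ`; C-3h
`hasAdditiveReductionAt_quadraticTwist_two_of_emod_four` at `ℓ = 2`, its `d_K % 4 = 1` DERIVED from
`hdodd` by `discr_emod_four`), and `3 ∣ c_v(W_d)` would make `W_d`
of type `IV`/`IV*` at `v` (§1), whence `c_w(W_{d,K}) = 3` by row T-MIL-B's FACT-FREE `K`-side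
(n1011-p08, hypothesis `ℓ ≠ 3` only) `= c_w(W_K)` by the A-4K transfer — against the `K`-side zero.
CONDITIONAL on `hA` (for `W` only). [cite: SilvermanATAEC1994, Cor. IV.9.2 (c),(d), IV.9.4 Steps 5, 8 and Table 4.1]
[cite: SilvermanAEC2009, Prop. VII.5.4 (a), VII.1 Prop. 1.3 (b)] -/
theorem sum_fibre_padicValNat_three_localTamagawaNumber_of_addv_of_inert_of_ne_IV
    (h2 : Module.finrank ℚ K = 2) (hdodd : Odd (NumberField.discr K))
    {Cd : VariableChange ℚ} (hWd : Cd • W.quadraticTwist (NumberField.discr K : ℚ) = Wd)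
    (hv3 : (primesEquiv v : ℕ) ≠ 3) (hnd : ¬ ((primesEquiv v : ℕ) : ℤ) ∣ NumberField.discr K)
    (hadd : W.HasAdditiveReductionAt v)
    (hIV : W.kodairaSymbolAt v ≠ .IV) (hIVs : W.kodairaSymbolAt v ≠ .IVstar)
    {w : HeightOneSpectrum (𝓞 K)}
    (hset : {w' : HeightOneSpectrum (𝓞 K) | w'.under (𝓞 ℚ) = v} = {w})
    (he : w.asIdeal.ramificationIdx (𝓞 ℚ) = 1) (hf : w.asIdeal.inertiaDeg (𝓞 ℚ) = 2)
    (hA : kodairaSymbolAt_baseChange_of_ramificationIdx_eq_one K v w W) :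
    ∑ w ∈ (HeightOneSpectrum.finite_setOf_under_eq_of_numberField (K := K) v).toFinset,
        padicValNat 3 (((W.baseChange K).baseChange (w.adicCompletion K)).localTamagawaNumber
          (w.adicCompletionIntegers K)) =
      padicValNat 3 ((W.baseChange (v.adicCompletion ℚ)).localTamagawaNumber
          (v.adicCompletionIntegers ℚ)) +
        padicValNat 3 ((Wd.baseChange (v.adicCompletion ℚ)).localTamagawaNumber
          (v.adicCompletionIntegers ℚ)) := by
  haveI : Fact (Nat.Prime 3) := ⟨Nat.prime_three⟩
  haveI : (W.baseChange K).IsElliptic := by rw [baseChange]; infer_instance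
  have hw : w.under (𝓞 ℚ) = v := under_eq_of_fibre_eq_singleton hset
  have hd0 : (NumberField.discr K : ℤ) ≠ 0 := NumberField.discr_ne_zero K
  have hdq : (NumberField.discr K : ℚ) ≠ 0 := by exact_mod_cast hd0
  haveI := W.isElliptic_quadraticTwist hdq
  -- `K`-side: additive of the same type, so `v₃ = 0`
  have haddK : (W.baseChange K).HasAdditiveReductionAt w :=
    hasAdditiveReductionAt_baseChange_of_unramifiedFact W hA hw he hadd
  have hsymK : (W.baseChange K).kodairaSymbolAt w = W.kodairaSymbolAt v :=
    kodairaSymbolAt_baseChange_eq_of_unramifiedFact W hA hw he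
  have hK : padicValNat 3 (((W.baseChange K).baseChange (w.adicCompletion K)).localTamagawaNumber
      (w.adicCompletionIntegers K)) = 0 :=
    padicValNat_localTamagawaNumber_eq_zero_of_hasAdditiveReductionAt_of_odd w (W.baseChange K) haddK 3
      (by norm_num) (fun _ => by rw [hsymK]; exact ⟨hIV, hIVs⟩)
  -- `ℚ`-side, `W`
  have hQ : padicValNat 3 ((W.baseChange (v.adicCompletion ℚ)).localTamagawaNumber
      (v.adicCompletionIntegers ℚ)) = 0 :=
    padicValNat_localTamagawaNumber_eq_zero_of_hasAdditiveReductionAt_of_odd v W hadd 3 (by norm_num)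
      (fun _ => ⟨hIV, hIVs⟩)
  -- `ℚ`-side, the twist: additive at `v`
  have haddT : (W.quadraticTwist (NumberField.discr K : ℚ)).HasAdditiveReductionAt v := by
    by_cases hv2 : (primesEquiv v : ℕ) = 2
    · have hd4 : NumberField.discr K % 4 = 1 := by
        rcases Literature.NumberTheory.QuadraticFields.Quadratic.discr_emod_four h2 with h | h
        · exfalso
          obtain ⟨k, hk⟩ := hdodd
          omega
        · exact h
      exact hasAdditiveReductionAt_quadraticTwist_two_of_emod_four v W hv2 hd4 hadd
    · exact (hasAdditiveReductionAt_quadraticTwist_of_not_dvd W v hv2 hnd hadd).1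
  have haddD : Wd.HasAdditiveReductionAt v := by
    rw [← hWd]
    exact (hasAdditiveReductionAt_smul_iff_holds v (W.quadraticTwist (NumberField.discr K : ℚ)) Cd).mpr
      haddT
  have hD : padicValNat 3 ((Wd.baseChange (v.adicCompletion ℚ)).localTamagawaNumber
      (v.adicCompletionIntegers ℚ)) = 0 := by
    by_contra hne
    have hdvd : 3 ∣ (Wd.baseChange (v.adicCompletion ℚ)).localTamagawaNumber
        (v.adicCompletionIntegers ℚ) := by
      by_contra hndvd
      exact hne (padicValNat.eq_zero_of_not_dvd hndvd)
    -- `W_d` is of type `IV`/`IV*` at `v`, so `c_w(W_{d,K}) = 3 = c_w(W_K)`: contradiction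
    have hIVd := kodairaSymbolAt_eq_IV_or_IVstar_of_three_dvd_localTamagawaNumber v Wd haddD hdvd
    obtain ⟨θ, hθ0, hθ⟩ := exists_sq_eq_discr h2
    have hfe : Even (w.asIdeal.inertiaDeg (𝓞 ℚ)) := by rw [hf]; exact even_two
    have h3K : ((W.baseChange K).baseChange (w.adicCompletion K)).localTamagawaNumber
        (w.adicCompletionIntegers K) = 3 := by
      rw [← localTamagawaNumber_baseChange_eq_of_twist W Wd w hWd hθ0 hθ]
      rcases hIVd with h | h
      · exact TypeIVTwist.localTamagawaNumber_baseChange_eq_three_of_kodairaSymbolAt_eq_IV_of_unramified_of_even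
          v Wd hv3 h hw he hfe
      · exact TypeIVTwist.localTamagawaNumber_baseChange_eq_three_of_kodairaSymbolAt_eq_IVstar_of_unramified_of_even
          v Wd hv3 h hw he hfe
    rw [h3K] at hK
    simp at hK
  rw [toFinset_eq_singleton_of_fibre hset, Finset.sum_singleton, hK, hQ, hD]

end InertNeIV

/-! ## §4 The END at every odd `p`, conditional on A233 -/

section End

variable (W : WeierstrassCurve ℚ) [W.IsElliptic] [W.IsGloballyMinimal]
  (K : Type) [Field K] [NumberField K] (Wd : WeierstrassCurve ℚ) [Wd.IsElliptic] [Wd.IsGloballyMinimal]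
  (W' : WeierstrassCurve K) [W'.IsGloballyMinimal]

/-- **(T) at a place from the local S₃ hypothesis WITH THE `p = 3` PROVISO, every odd `p`, GIVEN A233
above `v`** (`W/ℚ` globally minimal, `K` quadratic, `d_K` odd squarefree, `W_d = C_d • W^{(d_K)}`):
`Σ_{w | v} v_p(c_w(W_K)) = v_p(c_v(W)) + v_p(c_v(W_d))` when `W` is good ∨ multiplicative ∨
(`ℓ_v ∣ d_K` ∧ `W_d` multiplicative) at `v` (FILE C-3f, fact-free) ∨ `W` additive at `v` with
`ℓ_v ∤ d_K` and the proviso `p = 3 → ℓ_v ≠ 3 ∧ (ℓ_v = 2 → d_K % 8 = 1 ∨ type ≠ IV, IV*)` (`2` split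
in `K` or not of type `IV`/`IV*`). For `p ≥ 5` this is FILE C-3h's theorem verbatim; at `p = 3`:
split `v` (C-3b, any type), inert `v` of type `IV`/`IV*` (row T-MIL-B B-3, n1011-p08, fact-free;
`ℓ ≠ 2, 3`) or of another type (§3, `hA`); ramified is excluded by `ℓ_v ∤ d_K`. CONDITIONAL on `hA`.
[cite: SilvermanAEC2009, Prop. VII.5.4 (a) and Thm. VII.6.1] [cite: SilvermanATAEC1994, IV.9.4 Steps 5, 8 and Table 4.1] -/
theorem sum_fibre_padicValNat_localTamagawaNumber_of_semistable_or_addv_of_unramifiedFact_odd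
    (h2 : Module.finrank ℚ K = 2)
    (hdodd : Odd (NumberField.discr K)) (hdsq : Squarefree (NumberField.discr K))
    {Cd : VariableChange ℚ} (hWd : Cd • W.quadraticTwist (NumberField.discr K : ℚ) = Wd)
    (p : ℕ) [hp : Fact p.Prime] (hp2 : p ≠ 2) (v : HeightOneSpectrum (𝓞 ℚ))
    (hA : ∀ w : HeightOneSpectrum (𝓞 K), kodairaSymbolAt_baseChange_of_ramificationIdx_eq_one K v w W)
    (hSv : W.HasGoodReductionAt v ∨ W.HasMultiplicativeReductionAt v ∨
      (((primesEquiv v : ℕ) : ℤ) ∣ NumberField.discr K ∧ Wd.HasMultiplicativeReductionAt v) ∨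
      (W.HasAdditiveReductionAt v ∧ ¬ ((primesEquiv v : ℕ) : ℤ) ∣ NumberField.discr K ∧
        (p = 3 → (primesEquiv v : ℕ) ≠ 3 ∧ ((primesEquiv v : ℕ) = 2 → NumberField.discr K % 8 = 1 ∨
          (W.kodairaSymbolAt v ≠ .IV ∧ W.kodairaSymbolAt v ≠ .IVstar))))) :
    ∑ w ∈ (HeightOneSpectrum.finite_setOf_under_eq_of_numberField (K := K) v).toFinset,
        padicValNat p (((W.baseChange K).baseChange (w.adicCompletion K)).localTamagawaNumber
          (w.adicCompletionIntegers K)) =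
      padicValNat p ((W.baseChange (v.adicCompletion ℚ)).localTamagawaNumber
          (v.adicCompletionIntegers ℚ)) +
        padicValNat p ((Wd.baseChange (v.adicCompletion ℚ)).localTamagawaNumber
          (v.adicCompletionIntegers ℚ)) := by
  by_cases hp3 : p = 3
  · subst hp3
    rcases hSv with h | h | h | ⟨hadd, hnd, hprov⟩
    · exact sum_fibre_padicValNat_localTamagawaNumber_of_semistable' W K Wd h2 hdodd hdsq hWd 3 hp2 v
        (Or.inl h)
    · exact sum_fibre_padicValNat_localTamagawaNumber_of_semistable' W K Wd h2 hdodd hdsq hWd 3 hp2 v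
        (Or.inr (Or.inl h))
    · exact sum_fibre_padicValNat_localTamagawaNumber_of_semistable' W K Wd h2 hdodd hdsq hWd 3 hp2 v
        (Or.inr (Or.inr h))
    · obtain ⟨hv3, h2IV'⟩ := hprov rfl
      rcases placesOver_trichotomy_of_finrank_eq_two K h2 v with
        ⟨w₁, w₂, hne, hset, hef⟩ | ⟨w, hset, he, hf⟩ | ⟨w, hset, he, hf⟩
      · exact sum_fibre_padicValNat_localTamagawaNumber_of_split W Wd 3 v h2 hWd hne hset hef
      · -- inert: over `2` this says `d_K % 8 ≠ 1` (tree `ncard_primesOver_two_eq_two_iff`)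
        have h2IV : (primesEquiv v : ℕ) = 2 → W.kodairaSymbolAt v ≠ .IV ∧ W.kodairaSymbolAt v ≠ .IVstar := by
          intro hv2
          refine (h2IV' hv2).resolve_left fun h8 => ?_
          have hsplit :=
            (Literature.NumberTheory.QuadraticFields.Quadratic.ncard_primesOver_two_eq_two_iff h2).mpr h8
          have h1 := ncard_primesOver_eq_one_of_fibre_singleton K v hset
          rw [hv2] at h1
          simp only [Nat.cast_ofNat] at h1
          rw [h1] at hsplit
          exact absurd hsplit (by decide)
        by_cases hIV : W.kodairaSymbolAt v = .IV
        · have hv2 : (primesEquiv v : ℕ) ≠ 2 := fun hv2 => (h2IV hv2).1 hIV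
          exact sum_fibre_padicValNat_localTamagawaNumber_of_kodairaSymbolAt_eq_IV_of_inert W Wd v h2
            hWd hv2 hv3 hIV hset he hf
        by_cases hIVs : W.kodairaSymbolAt v = .IVstar
        · have hv2 : (primesEquiv v : ℕ) ≠ 2 := fun hv2 => (h2IV hv2).2 hIVs
          exact sum_fibre_padicValNat_localTamagawaNumber_of_kodairaSymbolAt_eq_IVstar_of_inert W Wd v
            h2 hWd hv2 hv3 hIVs hset he hf
        exact sum_fibre_padicValNat_three_localTamagawaNumber_of_addv_of_inert_of_ne_IV W Wd v h2 hdodd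
          hWd hv3 hnd hadd hIV hIVs hset he hf (hA w)
      · exact absurd (natCast_dvd_discr_of_ramificationIdx_eq_two K v
          (under_eq_of_fibre_eq_singleton hset) he) hnd
  · have hp5 : 5 ≤ p := hp.out.five_le_of_ne_two_of_ne_three hp2 hp3
    refine sum_fibre_padicValNat_localTamagawaNumber_of_semistable_or_addv_of_unramifiedFact W K Wd h2
      hdodd hdsq hWd p hp5 v hA ?_
    rcases hSv with h | h | h | ⟨hadd, hnd, -⟩
    · exact Or.inl h
    · exact Or.inr (Or.inl h)
    · exact Or.inr (Or.inr (Or.inl h))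
    · exact Or.inr (Or.inr (Or.inr ⟨hadd, hnd⟩))

/-- **THE END at EVERY ODD `p` (`p = 3` included), CONDITIONAL on A233 — the odd Tamagawa identity
of Milne's quadratic BSD quotient with additive places prime to `d_K` allowed.** For `W/ℚ` globally
minimal elliptic, `K` quadratic with `d_K` odd squarefree, globally minimal models
`W_d = C_d • W^{(d_K)}` and `W' = C' • W_K`, the named fact A233 at every pair `(v, w)` as
hypothesis `hA`, and `hS : ∀ v`, `W` good ∨ `W` multiplicative ∨ (`ℓ_v ∣ d_K` ∧ `W_d`
multiplicative) ∨ (`W` additive ∧ `ℓ_v ∤ d_K` ∧ the `p = 3` proviso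
`p = 3 → ℓ_v ≠ 3 ∧ (ℓ_v = 2 → d_K % 8 = 1 ∨ (W.kodairaSymbolAt v ≠ IV ∧ W.kodairaSymbolAt v ≠ IV*))`),
every odd prime `p`:
`v_p(|N_{K/ℚ}(C'.u)| · ∏_w c_w(W')) = v_p(|C_d.u| · ∏_v c_v(W) · ∏_v c_v(W_d))` — the body of `hodd`.
Assembly: FILE C-2 schema with (T) from the previous theorem at every `v` and (D) at `v₀ ↔ p` from
FILE C-3g (at `v₀` the hypothesis is an S₂ one: `ℓ_{v₀} = p ≥ 5`, or `p = 3` where the proviso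
forbids the additive unramified disjunct). For `p ≥ 5` this is FILE C-3h's END. CONDITIONAL on `hA`;
closes no class. [cite: Milne1972ArithmeticAV, §1 Thm. 1 and §2 (through DokchitserDokchitserAnnals2010, §2.1, proof of Thm. 8)]
[cite: SilvermanAEC2009, Prop. VII.5.4 (a), Thm. VII.6.1] [cite: SilvermanATAEC1994, IV.9.4 Steps 5, 8 and Table 4.1] -/
theorem padicValRat_norm_mul_tamagawaProduct_eq_of_unramifiedFact_odd (h2 : Module.finrank ℚ K = 2)
    (hdodd : Odd (NumberField.discr K)) (hdsq : Squarefree (NumberField.discr K))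
    {Cd : VariableChange ℚ} (hWd : Cd • W.quadraticTwist (NumberField.discr K : ℚ) = Wd)
    {C' : VariableChange K} (hW' : C' • W.baseChange K = W')
    (hA : ∀ (v : HeightOneSpectrum (𝓞 ℚ)) (w : HeightOneSpectrum (𝓞 K)),
      kodairaSymbolAt_baseChange_of_ramificationIdx_eq_one K v w W)
    (p : ℕ) [hp : Fact p.Prime] (hp2 : p ≠ 2)
    (hS : ∀ v : HeightOneSpectrum (𝓞 ℚ), W.HasGoodReductionAt v ∨ W.HasMultiplicativeReductionAt v ∨
      (((primesEquiv v : ℕ) : ℤ) ∣ NumberField.discr K ∧ Wd.HasMultiplicativeReductionAt v) ∨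
      (W.HasAdditiveReductionAt v ∧ ¬ ((primesEquiv v : ℕ) : ℤ) ∣ NumberField.discr K ∧
        (p = 3 → (primesEquiv v : ℕ) ≠ 3 ∧ ((primesEquiv v : ℕ) = 2 → NumberField.discr K % 8 = 1 ∨
          (W.kodairaSymbolAt v ≠ .IV ∧ W.kodairaSymbolAt v ≠ .IVstar))))) :
    padicValRat p (|Algebra.norm ℚ (C'.u : K)| * W'.tamagawaProduct : ℚ) =
      padicValRat p (|(Cd.u : ℚ)| * (W.tamagawaProduct * Wd.tamagawaProduct) : ℚ) := by
  set v₀ : HeightOneSpectrum (𝓞 ℚ) := (primesEquiv (R := 𝓞 ℚ)).symm ⟨p, hp.out⟩ with hv₀def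
  have hv₀ : (primesEquiv v₀ : ℕ) = p := by
    rw [hv₀def, Equiv.apply_symm_apply]
  have hv₀2 : (primesEquiv v₀ : ℕ) ≠ 2 := by rw [hv₀]; exact hp2
  have hu' : (C'.u : K) ≠ 0 := Units.ne_zero _
  have hud : (Cd.u : ℚ) ≠ 0 := Units.ne_zero _
  have hT := fun v => sum_fibre_padicValNat_localTamagawaNumber_of_semistable_or_addv_of_unramifiedFact_odd
    W K Wd h2 hdodd hdsq hWd p hp2 v (hA v) (hS v)
  -- at `v₀` the hypothesis is an S₂ hypothesis (`ℓ_{v₀} = p ≥ 5`, or `p = 3` and the proviso bites)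
  have hS₀ : W.HasGoodReductionAt v₀ ∨ W.HasMultiplicativeReductionAt v₀ ∨
      (((primesEquiv v₀ : ℕ) : ℤ) ∣ NumberField.discr K ∧ Wd.HasMultiplicativeReductionAt v₀) ∨
      (W.HasAdditiveReductionAt v₀ ∧ ¬ ((primesEquiv v₀ : ℕ) : ℤ) ∣ NumberField.discr K ∧
        5 ≤ (primesEquiv v₀ : ℕ)) := by
    rcases hS v₀ with h | h | h | ⟨ha, hn, hprov⟩
    · exact Or.inl h
    · exact Or.inr (Or.inl h)
    · exact Or.inr (Or.inr (Or.inl h))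
    · refine Or.inr (Or.inr (Or.inr ⟨ha, hn, ?_⟩))
      by_cases hp3 : p = 3
      · exact absurd hv₀ (by rw [hp3]; exact (hprov hp3).1)
      · rw [hv₀]; exact hp.out.five_le_of_ne_two_of_ne_three hp2 hp3
  have hD := sum_fibre_inertiaDeg_mul_ord_u_eq_of_semistable_or_addv W K Wd W' h2 hdsq hWd hW' v₀
    hv₀2 hS₀
  refine padicValRat_norm_mul_tamagawaProduct_eq_of_local_baseChange W Wd W' hW' hu' hud p v₀ hv₀
    (fun v _ => hT v) ?_
  rw [Finset.sum_add_distrib, hD, ← Nat.cast_sum, hT v₀, Nat.cast_add]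

end End

end Summit.BirchSwinnertonDyer.Rank1Residual.AdditivePotMult

end
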